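import Literature.AnabelianGeometry.SemiGraphs.WitnessIwahoriApprox

/-!
# The finite levels `U_n`, `P_n` of the estranged-loop witness: inhabited, of the printed orders `pⁿ`, `p²ⁿ`,
# and reached from `U`, `P` (NV-L3 wave bookkeeping for `IwUMod`, `IwMod`)

S. Mochizuki, *Semi-graphs of anabelioids*, Publ. RIMS **42** (2006) 221–322, Def. 2.3 (i)–(iii) pp. 24–25
(approximators of a semi-graph of anabelioids by finite groups) [cite: MochizukiSemiAnbd2006, Def 2.3(i) p.24].
abc-iut cell, layer L3, PROOF-ONLY file (seat abc-iut-w5-d149 gen 3; row family «NV-L3»; abc-iut-w4-d098's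
INHABITATION-CENSUS-L3-v1 §A1 lists `IwUMod` and `IwMod` — the finite levels `U_n = (1 + pℤ_p)/(1 + pⁿ⁺¹…)`-style
quotients of the witness file `WitnessIwahoriApprox.lean` (abc-iut-L3 witness row WIT-1b) — with ZERO producers,
because its producers `toMod`, `brMod` are `MonoidHom`-valued and its `One`/`Group` instances are not defs).
GENUINE and elementary: the levels are nonempty finite groups of orders `pⁿ` and `pⁿ·pⁿ`, non-trivial for
`n ≥ 1`, and every element is the reduction of an element of `U` (resp. `P`).  No `def`, no `instance`.
Nothing here bears on [IUTchIII] Cor. 3.12.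
-/

noncomputable section

namespace Literature.AnabelianGeometry.SemiGraphs

variable (p : ℕ) [Fact p.Prime] (n : ℕ)

/-- `U_n` is inhabited (by its unit). [cite: MochizukiSemiAnbd2006, Def 2.3(i) p.24] -/
theorem IwUMod.nonempty : Nonempty (IwUMod p n) := ⟨1⟩

/-- `P_n` is inhabited (by its unit). [cite: MochizukiSemiAnbd2006, Def 2.3(i) p.24] -/
theorem IwMod.nonempty : Nonempty (IwMod p n) := ⟨1⟩

/-- `|U_n| = pⁿ` (the coordinate `s ∈ ℤ/pⁿ`). [cite: MochizukiSemiAnbd2006, Def 2.3(i) p.24] -/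
theorem IwUMod.card_eq : Nat.card (IwUMod p n) = p ^ n := by
  rw [Nat.card_congr (IwUMod.equivZMod (p := p) (n := n)), Nat.card_zmod]

/-- `|P_n| = pⁿ · pⁿ` (the coordinates `(a, s) ∈ (ℤ/pⁿ)²`). [cite: MochizukiSemiAnbd2006, Def 2.3(i) p.24] -/
theorem IwMod.card_eq : Nat.card (IwMod p n) = p ^ n * p ^ n := by
  rw [Nat.card_congr (IwMod.equivProd (p := p) (n := n)), Nat.card_prod, Nat.card_zmod]

/-- `U_n` is non-trivial for `n ≥ 1`. [cite: MochizukiSemiAnbd2006, Def 2.3(i) p.24] -/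
theorem IwUMod.nontrivial (hn : 1 ≤ n) : Nontrivial (IwUMod p n) := by
  have hp : 1 < p := (Fact.out : p.Prime).one_lt
  have hcard : 1 < Nat.card (IwUMod p n) := by
    rw [IwUMod.card_eq]
    exact Nat.one_lt_pow (by omega) hp
  exact Finite.one_lt_card_iff_nontrivial.mp hcard

/-- `P_n` is non-trivial for `n ≥ 1`. [cite: MochizukiSemiAnbd2006, Def 2.3(i) p.24] -/
theorem IwMod.nontrivial (hn : 1 ≤ n) : Nontrivial (IwMod p n) := by
  have hp : 1 < p := (Fact.out : p.Prime).one_lt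
  have hcard : 1 < Nat.card (IwMod p n) := by
    rw [IwMod.card_eq]
    have h1 : 1 < p ^ n := Nat.one_lt_pow (by omega) hp
    calc 1 < p ^ n := h1
      _ ≤ p ^ n * p ^ n := Nat.le_mul_of_pos_right _ (by omega)
  exact Finite.one_lt_card_iff_nontrivial.mp hcard

/-- Every element of `U_n` is the reduction of an element of `U = 1 + pℤ_p` (the approximator is
`π₁`-epimorphic on the edge group). [cite: MochizukiSemiAnbd2006, Def 2.3(ii) p.25] -/
theorem IwUMod.exists_toMod_eq (x : IwUMod p n) : ∃ u : IwU p, IwU.toMod n u = x :=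
  IwU.toMod_surjective (p := p) n x

/-- Every element of `P_n` is the reduction of an element of `P = ℤ_p ⋊ (1 + pℤ_p)` (the approximator is
`π₁`-epimorphic on the vertex group). [cite: MochizukiSemiAnbd2006, Def 2.3(ii) p.25] -/
theorem IwMod.exists_toMod_eq (x : IwMod p n) : ∃ g : Iw p, Iw.toMod n g = x :=
  Iw.toMod_surjective (p := p) n x

end Literature.AnabelianGeometry.SemiGraphs

end
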